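import Summits.HodgeConjecture.HodgeConjecture.Theorems.MarkmanPartnerTransportPartnerOfMinusTwoClass
import Summits.HodgeConjecture.HodgeConjecture.Theorems.MarkmanPartnerTransportPartnerTransport
import Summits.HodgeConjecture.HodgeConjecture.Theorems.EndoscopicMiddleDegreeCupProductAlgebraic

/-!
# Route MarkmanPartnerTransport · crux `LowPicardRealMultiplication` (#5, stmt-HodgeConjecture-19653) — X3a's
# pay-off: HC⁴(X) from HC⁴ of the K3 PARTNER squares, for `X` with a rational Néron–Severi class of square `−2`

Sibling of `…PartnerOfMinusTwoClass` (X3a: the K3 partner of a marked `K3^{[2]}`-type fourfold whose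
`NS(X)_ℚ` represents `−2`, Hasse–Minkowski-free, every Picard rank), kept separate because it consumes the route's
`partnerTransport_explicit` (`…PartnerTransport`, item #2, modulo four printed facts), whose module imports the
route file (Theses cone).

* `hodgeConjectureFor_of_minusTwoClass_of_partnerSquares` — **HC⁴(X) ⟸ HC⁴(S ⊗ S) for every projective K3
  partner `(S, η, p, x, g)` of `X`** (marked, (g1)–(g7), `ρ(X) ≤ ρ(S) + 1`; so `T(S)_ℚ ≅ T(X)_ℚ` as rational Hodge
  structures with their forms and every K3-side rung for that rational type applies), for `(X, φ, P, z)` marked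
  smooth projective of `K3^{[2]}`-type with `v ∈ N¹(X)` rational, `q(φ v) = −2` — modulo
  {`Huybrechts_K3_periodSurjective_projective`, `Beauville1983_hilbertSquare_markedIncidence`,
  `Beauville1983_hilbertSquare_blowupDiagonal_surjection`, `Markman2024_rationalHodgeIsometry_lift_algebraic_marked`}
  (the multiplicativity of algebraic classes being the tree's `Theorems.Voisin2003_cupProduct_algebraicClasses_holds`).
  At `ρ(X) ≥ 4` the class `v` is free (`PartnerExistence`, Hasse–Minkowski); at `ρ(X) = 3` — crux #5's range,
  where `PartnerExistence` does not apply — it is the honest hypothesis separating X3a from the residue X3b.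

CONDITIONAL; no definition, no sorry, no new named fact; credits nothing; crux #5 and HC stay open. Prover seat
hodge-nonav-19716-p2 (gen 4), `--supports stmt-HodgeConjecture-19653`.

References: E. Markman, Compos. Math. 160 (2024) Thm. 1.1, 1.4; A. Beauville, J. Differential Geom. 18 (1983)
§6, §9; D. Huybrechts, *Lectures on K3 Surfaces*, Ch. 6 Thm. 3.1, Ch. 7 Thm. 4.1; J.-P. Serre, *A Course in
Arithmetic*, Ch. IV §1.5.
-/

noncomputable section

set_option linter.dupNamespace false

open Module CategoryTheory MonoidalCategory
open Literature.AlgebraicTopology.SingularHomology Literature.Geometry.Kaehler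
open Literature.AlgebraicGeometry Literature.AlgebraicGeometry.Motives Literature.AlgebraicGeometry.HodgeTheory
open Literature.AlgebraicGeometry.Hyperkaehler Literature.AlgebraicGeometry.Surfaces Literature.AlgebraicGeometry.HilbertScheme
open Summit.HodgeConjecture.HodgeConjecture.Theorems.NikulinTwinTransport
open Summit.HodgeConjecture.HodgeConjecture.Theorems.MarkmanPartnerTransport.BBFPositivity

namespace Summit.HodgeConjecture.HodgeConjecture.Theorems.MarkmanPartnerTransport.PartnerLattice

/-- `MarkedK3Sq[X, φ, P, z]`: VERBATIM the `let MarkedK3Sq := …` binder of the route declarations of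
MarkmanPartnerTransport (clauses (m1)–(m6)). Local notation only. -/
local notation3 (prettyPrint := false) "MarkedK3Sq[" X ", " φ ", " P ", " z "]" =>
  (((IsIntegralClass P ∧ ∀ Q : complexBetti X (2 * 4), IsIntegralClass Q → ∃ n : ℤ, Q = n • P) ∧
    (∀ c : complexBetti X 2, IsIntegralClass c ↔ ∃ v : K3HilbertIndex → ℤ, φ c = fun i => (v i : ℂ)) ∧
    (∀ a : complexBetti X 2, cupPowTwo a 4 = ((3 : ℂ) * (k3HilbertForm 2 (φ a) (φ a)) ^ 2) • P) ∧
    (IsOfHodgeType 4 X 2 2 0 (LinearEquiv.symm φ z) ∧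
      ∀ τ : complexBetti X 2, IsOfHodgeType 4 X 2 2 0 τ → ∃ t : ℂ, τ = t • LinearEquiv.symm φ z) ∧
    (∀ c : complexBetti X 2, IsOfHodgeType 4 X 2 1 1 c ↔
      (k3HilbertForm 2 (φ c) z = 0 ∧ k3HilbertForm 2 (φ c) (star z) = 0)) ∧
    (k3HilbertForm 2 z z = 0 ∧ 0 < (k3HilbertForm 2 (star z) z).re)))

variable {X : SchemeOver ℂ} {φ : complexBetti X 2 ≃ₗ[ℂ] (K3HilbertIndex → ℂ)} {P : complexBetti X (2 * 4)}
  {z : K3HilbertIndex → ℂ}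

/-! ### §4 HC⁴(X) from the K3 side, for `X` with a rational algebraic class of square `−2` -/

/-- **The `X`-side of every K3-side rung, at ANY Picard rank, for `X` whose rational Néron–Severi space
represents `−2`.**  For a marked smooth projective `K3^{[2]}`-type `(X, φ, P, z)` with `v ∈ N¹(X)` rational,
`q(φ v) = −2`: if `HC⁴(S ⊗ S)` holds for every projective K3 partner `(S, η, p, x, g)` of `X` (marked, with
(g1)–(g7) and `ρ(X) ≤ ρ(S) + 1` — so `T(S)_ℚ ≅ T(X)_ℚ` as rational Hodge structures with their forms, and any
K3-side rung for that rational RM ∕ CM ∕ general type applies), then `HodgeConjectureFor 4 X`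
(`exists_k3Partner_of_minusTwoClass` + the route's `partnerTransport_explicit`). Modulo the four printed facts
{`Huybrechts_K3_periodSurjective_projective`, `Beauville1983_hilbertSquare_markedIncidence`,
`Beauville1983_hilbertSquare_blowupDiagonal_surjection`, `Markman2024_rationalHodgeIsometry_lift_algebraic_marked`}
(the multiplicativity of algebraic classes is the tree's `Theorems.Voisin2003_cupProduct_algebraicClasses_holds`).
At `ρ(X) ≥ 4` the `−2` class is free (Hasse–Minkowski, `PartnerExistence`); at `ρ(X) = 3` it is the honest
hypothesis separating X3a from the residue X3b (ternary `NS(X)_ℚ` not representing `−2`: no partner, no common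
smooth model with a Hilbert square). CONDITIONAL; credits nothing; HC not proved.
[cite: Markman2024, §1.1 Thm. 1.1 and Thm. 1.4] [cite: Beauville1983, §6 (e)–(f), Prop. 6 and §9 Lemme 1]
[cite: Huybrechts2016K3, Ch. 6 Thm. 3.1, Ch. 7 Thm. 4.1] [cite: Serre1973, Ch. IV §1.5 Thm. 3] -/
theorem hodgeConjectureFor_of_minusTwoClass_of_partnerSquares (hP : Huybrechts_K3_periodSurjective_projective)
    (hB : Beauville1983_hilbertSquare_markedIncidence) (hρ : Beauville1983_hilbertSquare_blowupDiagonal_surjection)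
    (hMk : Markman2024_rationalHodgeIsometry_lift_algebraic_marked)
    (hX : IsSmoothProjective 4 X) (hK : IsOfK3HilbertSquareType X) (hM : MarkedK3Sq[X, φ, P, z])
    {v : complexBetti X 2} (hv : v ∈ algebraicClasses X 1) (hvrat : IsRationalClass v)
    (hq : k3HilbertForm 2 (φ v) (φ v) = -2)
    (hsq : ∀ (S : SchemeOver ℂ) (η : complexBetti S (2 * 1) ≃ₗ[ℂ] (K3Index → ℂ)) (p : complexBetti S (2 * 2))
      (x : K3Index → ℂ) (g : complexBetti S (2 * 1) →ₗ[ℂ] complexBetti X 2), IsK3Surface S →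
      (p ≠ 0 ∧ (IsIntegralClass p ∧ (∀ q : complexBetti S (2 * 2), IsIntegralClass q → ∃ n : ℤ, q = n • p) ∧
        (∀ c : complexBetti S (2 * 1), IsIntegralClass c ↔ ∃ v : K3Index → ℤ, η c = fun i => (v i : ℂ)) ∧
        (∀ a b : complexBetti S (2 * 1), cupProduct (rfl : 2 * 1 + 2 * 1 = 2 * 2) a b = k3Form (η a) (η b) • p) ∧
        IsOfHodgeType 2 S (2 * 1) 2 0 (LinearEquiv.symm η x) ∧
        (∀ τ : complexBetti S (2 * 1), IsOfHodgeType 2 S (2 * 1) 2 0 τ → ∃ t : ℂ, τ = t • LinearEquiv.symm η x)) ∧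
        (k3Form x x = 0 ∧ 0 < (k3Form (star x) x).re ∧ ∃ u : K3Index → ℤ,
          k3Form (fun i => (u i : ℂ)) x = 0 ∧ 0 < ∑ i, ∑ j, u i * k3Gram i j * u j)) →
      ((∀ a, IsRationalClass a → IsRationalClass (g a)) ∧
        (∀ (i j : ℕ) a, IsOfHodgeType 2 S (2 * 1) i j a → IsOfHodgeType 4 X 2 i j (g a)) ∧
        (∀ d ∈ algebraicClasses S 1, g d = 0) ∧
        (∀ a, ∀ d : complexBetti X 2, d ∈ algebraicClasses X 1 → k3HilbertForm 2 (φ (g a)) (φ d) = 0) ∧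
        (∀ a b, (∀ d ∈ algebraicClasses S 1, cupProduct (rfl : 2 * 1 + 2 * 1 = 2 * 2) a d = 0) →
          (∀ d ∈ algebraicClasses S 1, cupProduct (rfl : 2 * 1 + 2 * 1 = 2 * 2) b d = 0) →
          k3HilbertForm 2 (φ (g a)) (φ (g b)) = k3Form (η a) (η b)) ∧
        (∀ y, (∀ d : complexBetti X 2, d ∈ algebraicClasses X 1 → k3HilbertForm 2 (φ y) (φ d) = 0) →
          ∃ a, (∀ d ∈ algebraicClasses S 1, cupProduct (rfl : 2 * 1 + 2 * 1 = 2 * 2) a d = 0) ∧ g a = y) ∧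
        (∀ y, (∀ d : complexBetti X 2, d ∈ algebraicClasses X 1 → k3HilbertForm 2 (φ y) (φ d) = 0) →
          IsRationalClass y →
          ∃ a, (∀ d ∈ algebraicClasses S 1, cupProduct (rfl : 2 * 1 + 2 * 1 = 2 * 2) a d = 0) ∧
            IsRationalClass a ∧ g a = y)) →
      Module.finrank ℂ (algebraicClasses X 1) ≤ Module.finrank ℂ (algebraicClasses S 1) + 1 →
      HodgeConjectureFor 4 (S ⊗ S)) :
    HodgeConjectureFor 4 X := by
  obtain ⟨S, η, p, x, g, hS, hMS, hg, hρS⟩ := exists_k3Partner_of_minusTwoClass hP hX hM hv hvrat hq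
  have hHC : HodgeConjectureFor 4 (S ⊗ S) := hsq S η p x g hS hMS hg hρS
  obtain ⟨-, hmk, hxx, hxpos, hu⟩ := hMS
  obtain ⟨hg1, hg2, -, -, hg5, -, -⟩ := hg
  exact partnerTransport_explicit hB hρ hMk Theorems.Voisin2003_cupProduct_algebraicClasses_holds hX hK hM hS hmk
    hxx hxpos hu hg1 hg2 hg5 hHC

end Summit.HodgeConjecture.HodgeConjecture.Theorems.MarkmanPartnerTransport.PartnerLattice

end
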